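import Summits.Ventures.PercRepro.C025ProfilePLDSolidLiftArithEight

/-!
# THE SOLID U_{4,m} FOR EVERY m ≥ 8 FROM THE CASE m = 8 AND THE EXACT RANK-9 PRESERVERS: THE ARITHMETIC (night-3 g34)

`proofs/NIGHT3-G34-FASTLIFT.md` §3.  At rank ≤ 9 the joint-LP search (kit j329966 / j329877, two independent runs) returns the
preservers q₄ = T₁₄ + 2·T₂₄ + 3·T₃₄ (unchanged) and q₄′ = T₂₄ + 4·T₃₄ (the second preserver moves with the rank: +2 at rank ≤ 7,
+3 at rank 8, +4 at rank 9).  With q₄′ = T₂₄ + 4·T₃₄ the identity from the base `m₀ = 7` needs a NEGATIVE amount of `T₃₄` for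
`m = 8, 9`, so the base is `m₀ = 8` (the U_{4,8} certificate table at rank ≤ 9 is feasible, kit j330036) and, the case `m = 8`
split off, the identity is stated from `m = 9 + k`:
`6·(U_{4,9+k} − U_{4,8}) = (6 + 6k)·q₄ + (36 + 39k + 3k²)·q₄′ + (6 + 17k + 12k² + k³)·T₃₄ + 6(c_m − c₈)·δ₄₄` (`lift_alg_four_nine`),
reusing the nine-layer profile lemma `sum_choose_min_four_eight` (valid for `m ≥ 7`) and `sum_choose_mid4_mono_eight`.  `T₃₄` and
`δ₄₄` preserve PER-LAYER DOMINANCE (g29), the `q`'s do at rank ≤ 9 (certificate tables); hence the lift `lift_instance_four_nine`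
for every `8 ≤ m`.  No `def`, no `instance`, no notation.  Axioms: standard.
-/

namespace PercRepro

open Finset

namespace PLDFourLift

variable {ι : Type}

/-- `6·C(9+k, 2) = 216 + 51 * k + 3 * k * k`. -/
theorem choose_two_nine_nine (k : ℕ) : 6 * (9 + k).choose 2 = 216 + 51 * k + 3 * k * k := by
  have h := PLDSolidLift.two_mul_choose_two (9 + k)
  rw [show 9 + k - 1 = 8 + k by omega] at h
  nlinarith [h]

/-- `6·C(9+k, 3) = 504 + 191 * k + 24 * k * k + k * k * k`. -/
theorem choose_three_nine_nine (k : ℕ) : 6 * (9 + k).choose 3 = 504 + 191 * k + 24 * k * k + k * k * k := by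
  have h := PLDSolidLift.six_mul_choose_three (9 + k)
  rw [show 9 + k - 1 = 8 + k by omega, show 9 + k - 2 = 7 + k by omega] at h
  nlinarith [h]

/-- The linear algebra of the rank-4 lift from `m₀ = 8`, with the layer sums and the coefficients abstracted. -/
theorem lift_alg_four_nine (a04 a14 a24 a34 a44 a43 a42 a41 a40
    b04 b14 b24 b34 b44 b43 b42 b41 b40 k k' C2 C3 c₀ : ℕ)
    (hC2 : 6 * C2 = 216 + 51 * k + 3 * k * k)
    (hC3 : 6 * C3 = 504 + 191 * k + 24 * k * k + k * k * k)
    (h₀ : a04 + 8 * a14 + 28 * a24 + 56 * a34 + c₀ * a44 + 56 * a43 + 28 * a42 + 8 * a41 + a40 ≤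
      b04 + 8 * b14 + 28 * b24 + 56 * b34 + c₀ * b44 + 56 * b43 + 28 * b42 + 8 * b41 + b40)
    (hq : (a14 + a41) + 2 * (a24 + a42) + 3 * (a34 + a43) ≤ (b14 + b41) + 2 * (b24 + b42) + 3 * (b34 + b43))
    (hq' : (a24 + a42) + 4 * (a34 + a43) ≤ (b24 + b42) + 4 * (b34 + b43))
    (hT : a34 + a43 ≤ b34 + b43) (hS : a44 ≤ b44) :
    a04 + (9 + k) * a14 + C2 * a24 + C3 * a34 + (c₀ + k') * a44 + C3 * a43 + C2 * a42 + (9 + k) * a41 + a40 ≤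
      b04 + (9 + k) * b14 + C2 * b24 + C3 * b34 + (c₀ + k') * b44 + C3 * b43 + C2 * b42 + (9 + k) * b41 + b40 := by
  have eC2a24 : 6 * C2 * a24 = (216 + 51 * k + 3 * k * k) * a24 := by rw [hC2]
  have eC2a42 : 6 * C2 * a42 = (216 + 51 * k + 3 * k * k) * a42 := by rw [hC2]
  have eC2b24 : 6 * C2 * b24 = (216 + 51 * k + 3 * k * k) * b24 := by rw [hC2]
  have eC2b42 : 6 * C2 * b42 = (216 + 51 * k + 3 * k * k) * b42 := by rw [hC2]
  have eC3a34 : 6 * C3 * a34 = (504 + 191 * k + 24 * k * k + k * k * k) * a34 := by rw [hC3]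
  have eC3a43 : 6 * C3 * a43 = (504 + 191 * k + 24 * k * k + k * k * k) * a43 := by rw [hC3]
  have eC3b34 : 6 * C3 * b34 = (504 + 191 * k + 24 * k * k + k * k * k) * b34 := by rw [hC3]
  have eC3b43 : 6 * C3 * b43 = (504 + 191 * k + 24 * k * k + k * k * k) * b43 := by rw [hC3]
  have hqk := Nat.mul_le_mul_left ((6 + 6 * k)) hq
  have hq'k := Nat.mul_le_mul_left ((36 + 39 * k + 3 * k * k)) hq'
  have hTk := Nat.mul_le_mul_left ((6 + 17 * k + 12 * k * k + k * k * k)) hT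
  have hSk := Nat.mul_le_mul_left (6 * k') hS
  linarith [eC2a24, eC2a42, eC2b24, eC2b42, eC3a34, eC3a43, eC3b34, eC3b43, hqk, hq'k, hTk, hSk, h₀]

/-- THE LIFT IN `m` FOR `U_{4,m}` from `m₀ = 8`: for a family `(s, x, f)` with (PLD), `8 ≤ m`, an admissible `(lo, hi, δ, Θ)`,
the preserver instances and the `U_{4,8}`-instance give the `U_{4,m}`-instance. -/
theorem lift_instance_four_nine (s : Finset ι) (x f : ι → ℕ)
    (hPLD : ∀ lo hi δ Θ : ℕ, Θ ≤ lo + hi + δ → (lo = 0 ∨ lo + hi + δ ≤ Θ) →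
      ∑ i ∈ s, (if lo ≤ x i ∧ x i ≤ hi ∧ Θ ≤ f i + x i then (f i).choose δ else 0) ≤
        ∑ i ∈ s, (if lo + δ ≤ f i ∧ f i ≤ hi + δ then (f i).choose δ else 0))
    (m : ℕ) (hm : 8 ≤ m) (lo hi δ Θ : ℕ) (hΘ : Θ ≤ lo + hi + δ) (hlo : lo = 0 ∨ lo + hi + δ ≤ Θ)
    (hq : ∑ i ∈ s, (((if lo ≤ x i + 1 ∧ x i + 1 ≤ hi ∧ Θ ≤ (f i + 4) + (x i + 1) then (f i + 4).choose δ else 0) + (if lo ≤ x i + 4 ∧ x i + 4 ≤ hi ∧ Θ ≤ (f i + 1) + (x i + 4) then (f i + 1).choose δ else 0)) + 2 * ((if lo ≤ x i + 2 ∧ x i + 2 ≤ hi ∧ Θ ≤ (f i + 4) + (x i + 2) then (f i + 4).choose δ else 0) + (if lo ≤ x i + 4 ∧ x i + 4 ≤ hi ∧ Θ ≤ (f i + 2) + (x i + 4) then (f i + 2).choose δ else 0)) + 3 * ((if lo ≤ x i + 3 ∧ x i + 3 ≤ hi ∧ Θ ≤ (f i + 4) + (x i + 3) then (f i + 4).choose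 δ else 0) + (if lo ≤ x i + 4 ∧ x i + 4 ≤ hi ∧ Θ ≤ (f i + 3) + (x i + 4) then (f i + 3).choose δ else 0))) ≤ ∑ i ∈ s, (((if lo + δ ≤ f i + 4 ∧ f i + 4 ≤ hi + δ then (f i + 4).choose δ else 0) + (if lo + δ ≤ f i + 1 ∧ f i + 1 ≤ hi + δ then (f i + 1).choose δ else 0)) + 2 * ((if lo + δ ≤ f i + 4 ∧ f i + 4 ≤ hi + δ then (f i + 4).choose δ else 0) + (if lo + δ ≤ f i + 2 ∧ f i + 2 ≤ hi + δ then (f i + 2).choose δ else 0)) + 3 * ((if lo + δ ≤ f i + 4 ∧ f i + 4 ≤ hi + δ then (f i + 4).choose δ else 0) + (if lo + δ ≤ f i + 3 ∧ f i + 3 ≤ hi + δ then (f i + 3).choose δ else 0))))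
    (hq' : ∑ i ∈ s, (((if lo ≤ x i + 2 ∧ x i + 2 ≤ hi ∧ Θ ≤ (f i + 4) + (x i + 2) then (f i + 4).choose δ else 0) + (if lo ≤ x i + 4 ∧ x i + 4 ≤ hi ∧ Θ ≤ (f i + 2) + (x i + 4) then (f i + 2).choose δ else 0)) + 4 * ((if lo ≤ x i + 3 ∧ x i + 3 ≤ hi ∧ Θ ≤ (f i + 4) + (x i + 3) then (f i + 4).choose δ else 0) + (if lo ≤ x i + 4 ∧ x i + 4 ≤ hi ∧ Θ ≤ (f i + 3) + (x i + 4) then (f i + 3).choose δ else 0))) ≤ ∑ i ∈ s, (((if lo + δ ≤ f i + 4 ∧ f i + 4 ≤ hi + δ then (f i + 4).choose δ else 0) + (if lo + δ ≤ f i + 2 ∧ f i + 2 ≤ hi + δ then (f i + 2).choose δ else 0)) + 4 * ((if lo + δ ≤ f i + 4 ∧ f i + 4 ≤ hi + δ then (f i + 4).choose δ else 0) + (if lo + δ ≤ f i + 3 ∧ f i + 3 ≤ hi + δ then (f i + 3).choose δ else 0))))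
    (h₀ : ∑ i ∈ s, ∑ j ∈ range (8 + 1), Nat.choose 8 j *
        (if lo ≤ x i + min j 4 ∧ x i + min j 4 ≤ hi ∧ Θ ≤ (f i + min (8 - j) 4) + (x i + min j 4) then
          (f i + min (8 - j) 4).choose δ else 0) ≤
      ∑ i ∈ s, ∑ j ∈ range (8 + 1), Nat.choose 8 j *
        (if lo + δ ≤ f i + min (8 - j) 4 ∧ f i + min (8 - j) 4 ≤ hi + δ then (f i + min (8 - j) 4).choose δ else 0)) :
    ∑ i ∈ s, ∑ j ∈ range (m + 1), Nat.choose m j *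
        (if lo ≤ x i + min j 4 ∧ x i + min j 4 ≤ hi ∧ Θ ≤ (f i + min (m - j) 4) + (x i + min j 4) then
          (f i + min (m - j) 4).choose δ else 0) ≤
      ∑ i ∈ s, ∑ j ∈ range (m + 1), Nat.choose m j *
        (if lo + δ ≤ f i + min (m - j) 4 ∧ f i + min (m - j) 4 ≤ hi + δ then (f i + min (m - j) 4).choose δ else 0) := by
  -- the preservers `T_{3,4}` and `δ_{44}`
  have h11 : ∀ lo hi δ Θ : ℕ, Θ ≤ lo + hi + δ → (lo = 0 ∨ lo + hi + δ ≤ Θ) →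
      ∑ i ∈ s, (if lo ≤ x i + 1 ∧ x i + 1 ≤ hi ∧ Θ ≤ (f i + 1) + (x i + 1) then (f i + 1).choose δ else 0) ≤
        ∑ i ∈ s, (if lo + δ ≤ f i + 1 ∧ f i + 1 ≤ hi + δ then (f i + 1).choose δ else 0) :=
    fun lo hi δ Θ h1 h2 => PLDClosure.shift11 s x f hPLD lo hi δ Θ h1 h2
  have h22 : ∀ lo hi δ Θ : ℕ, Θ ≤ lo + hi + δ → (lo = 0 ∨ lo + hi + δ ≤ Θ) →
      ∑ i ∈ s, (if lo ≤ x i + 2 ∧ x i + 2 ≤ hi ∧ Θ ≤ (f i + 2) + (x i + 2) then (f i + 2).choose δ else 0) ≤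
        ∑ i ∈ s, (if lo + δ ≤ f i + 2 ∧ f i + 2 ≤ hi + δ then (f i + 2).choose δ else 0) :=
    fun lo hi δ Θ h1 h2 => PLDClosure.shift11 s (fun i => x i + 1) (fun i => f i + 1) h11 lo hi δ Θ h1 h2
  have h33 : ∀ lo hi δ Θ : ℕ, Θ ≤ lo + hi + δ → (lo = 0 ∨ lo + hi + δ ≤ Θ) →
      ∑ i ∈ s, (if lo ≤ x i + 3 ∧ x i + 3 ≤ hi ∧ Θ ≤ (f i + 3) + (x i + 3) then (f i + 3).choose δ else 0) ≤
        ∑ i ∈ s, (if lo + δ ≤ f i + 3 ∧ f i + 3 ≤ hi + δ then (f i + 3).choose δ else 0) :=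
    fun lo hi δ Θ h1 h2 => PLDClosure.shift11 s (fun i => x i + 2) (fun i => f i + 2) h22 lo hi δ Θ h1 h2
  have hT : ∑ i ∈ s, ((if lo ≤ x i + 3 ∧ x i + 3 ≤ hi ∧ Θ ≤ (f i + 4) + (x i + 3) then (f i + 4).choose δ else 0) + (if lo ≤ x i + 4 ∧ x i + 4 ≤ hi ∧ Θ ≤ (f i + 3) + (x i + 4) then (f i + 3).choose δ else 0)) ≤ ∑ i ∈ s, ((if lo + δ ≤ f i + 4 ∧ f i + 4 ≤ hi + δ then (f i + 4).choose δ else 0) + (if lo + δ ≤ f i + 3 ∧ f i + 3 ≤ hi + δ then (f i + 3).choose δ else 0)) :=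
    PLDClosure.coloop s (fun i => x i + 3) (fun i => f i + 3) h33 lo hi δ Θ hΘ hlo
  have hS : ∑ i ∈ s, (if lo ≤ x i + 4 ∧ x i + 4 ≤ hi ∧ Θ ≤ (f i + 4) + (x i + 4) then (f i + 4).choose δ else 0) ≤ ∑ i ∈ s, (if lo + δ ≤ f i + 4 ∧ f i + 4 ≤ hi + δ then (f i + 4).choose δ else 0) :=
    PLDClosure.shift11 s (fun i => x i + 3) (fun i => f i + 3) h33 lo hi δ Θ hΘ hlo
  -- the layers, for `m` and for `8`
  have hLm : ∀ n : ℕ, 8 ≤ n → ∀ i ∈ s, ∑ j ∈ range (n + 1), Nat.choose n j *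
        (if lo ≤ x i + min j 4 ∧ x i + min j 4 ≤ hi ∧ Θ ≤ (f i + min (n - j) 4) + (x i + min j 4) then
          (f i + min (n - j) 4).choose δ else 0) =
      (if lo ≤ x i ∧ x i ≤ hi ∧ Θ ≤ (f i + 4) + (x i) then (f i + 4).choose δ else 0) + n * (if lo ≤ x i + 1 ∧ x i + 1 ≤ hi ∧ Θ ≤ (f i + 4) + (x i + 1) then (f i + 4).choose δ else 0) + n.choose 2 * (if lo ≤ x i + 2 ∧ x i + 2 ≤ hi ∧ Θ ≤ (f i + 4) + (x i + 2) then (f i + 4).choose δ else 0) + n.choose 3 * (if lo ≤ x i + 3 ∧ x i + 3 ≤ hi ∧ Θ ≤ (f i + 4) + (x i + 3) then (f i + 4).choose δ else 0) + (∑ i ∈ Ico 4 (n - 3), n.choose i) * (if lo ≤ x i + 4 ∧ x i + 4 ≤ hi ∧ Θ ≤ (f i + 4) + (x i + 4) then (f i + 4).choose δ else 0) + n.choose 3 * (if lo ≤ x i + 4 ∧ x i + 4 ≤ hi ∧ Θ ≤ (f i + 3) + (x i + 4) then (f i + 3).choose δ else 0) + n.choose 2 * (if lo ≤ x i + 4 ∧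 x i + 4 ≤ hi ∧ Θ ≤ (f i + 2) + (x i + 4) then (f i + 2).choose δ else 0) + n * (if lo ≤ x i + 4 ∧ x i + 4 ≤ hi ∧ Θ ≤ (f i + 1) + (x i + 4) then (f i + 1).choose δ else 0) + (if lo ≤ x i + 4 ∧ x i + 4 ≤ hi ∧ Θ ≤ (f i) + (x i + 4) then (f i).choose δ else 0) :=
    fun n hn i _ => PLDFourLift.sum_choose_min_four_eight n (by omega)
      (fun a b => if lo ≤ x i + a ∧ x i + a ≤ hi ∧ Θ ≤ (f i + b) + (x i + a) then (f i + b).choose δ else 0)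
  have hRm : ∀ n : ℕ, 8 ≤ n → ∀ i ∈ s, ∑ j ∈ range (n + 1), Nat.choose n j *
        (if lo + δ ≤ f i + min (n - j) 4 ∧ f i + min (n - j) 4 ≤ hi + δ then (f i + min (n - j) 4).choose δ else 0) =
      (if lo + δ ≤ f i + 4 ∧ f i + 4 ≤ hi + δ then (f i + 4).choose δ else 0) + n * (if lo + δ ≤ f i + 4 ∧ f i + 4 ≤ hi + δ then (f i + 4).choose δ else 0) + n.choose 2 * (if lo + δ ≤ f i + 4 ∧ f i + 4 ≤ hi + δ then (f i + 4).choose δ else 0) + n.choose 3 * (if lo + δ ≤ f i + 4 ∧ f i + 4 ≤ hi + δ then (f i + 4).choose δ else 0) + (∑ i ∈ Ico 4 (n - 3), n.choose i) * (if lo + δ ≤ f i + 4 ∧ f i + 4 ≤ hi + δ then (f i + 4).choose δ else 0) + n.choose 3 * (if lo + δ ≤ f i + 3 ∧ f i + 3 ≤ hi + δ then (f i + 3).choose δ else 0) + n.choose 2 * (if lo + δ ≤ f i + 2 ∧ f i + 2 ≤ hi + δ then (f i + 2).choose δ else 0) + n * (if lo + δ ≤ f i + 1 ∧ f i + 1 ≤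 hi + δ then (f i + 1).choose δ else 0) + (if lo + δ ≤ f i ∧ f i ≤ hi + δ then (f i).choose δ else 0) :=
    fun n hn i _ => PLDFourLift.sum_choose_min_four_eight n (by omega)
      (fun _ b => if lo + δ ≤ f i + b ∧ f i + b ≤ hi + δ then (f i + b).choose δ else 0)
  rw [sum_congr rfl (hLm m hm), sum_congr rfl (hRm m hm)]
  rw [sum_congr rfl (hLm 8 le_rfl), sum_congr rfl (hRm 8 le_rfl)] at h₀
  simp only [sum_add_distrib, ← mul_sum] at h₀ hq hq' ⊢
  rw [sum_add_distrib, sum_add_distrib] at hT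
  -- the coefficients
  rcases Nat.eq_or_lt_of_le hm with hm0 | hm1
  · subst hm0; exact h₀
  have hm1' : 9 ≤ m := hm1
  obtain ⟨k, hk⟩ := Nat.exists_eq_add_of_le hm1'
  obtain ⟨k', hk'⟩ := Nat.exists_eq_add_of_le (PLDFourLift.sum_choose_mid4_mono_eight 8 m hm)
  have hC2 : 6 * m.choose 2 = 216 + 51 * k + 3 * k * k := by rw [hk]; exact choose_two_nine_nine k
  have hC3 : 6 * m.choose 3 = 504 + 191 * k + 24 * k * k + k * k * k := by rw [hk]; exact choose_three_nine_nine k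
  have hm0c2 : Nat.choose 8 2 = 28 := by decide
  have hm0c3 : Nat.choose 8 3 = 56 := by decide
  rw [hm0c2, hm0c3] at h₀
  rw [hk']
  rw [hk] at hC2 hC3 ⊢
  exact lift_alg_four_nine _ _ _ _ _ _ _ _ _ _ _ _ _ _ _ _ _ _ _ _ _ _ _ hC2 hC3 h₀ hq hq' hT hS

end PLDFourLift

end PercRepro
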